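import Summits.Schanuel.Schanuel.Theses.RigidCore
import Literature.NumberTheory.Transcendental.ExpPointsExamples
import Summits.Schanuel.Schanuel.Theorems.RigidCoreSparsityTwoNonRealJetFinite
import Summits.Schanuel.Schanuel.Theorems.RigidCoreSparsityTwoCuspZeroLogDensity
import Summits.Schanuel.Schanuel.Theorems.RigidCoreSparsityTwoClassicalClassesFinite
import Literature.NumberTheory.Transcendental.ExpPointsCuspTrichotomy
import Literature.NumberTheory.Transcendental.ExpPointsCoordinateChange
import Literature.NumberTheory.Transcendental.ExpPointsGeometryBasic
import Literature.NumberTheory.Transcendental.RationalCoordRelations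
import Literature.NumberTheory.Transcendental.CuspValueAlgebraic
import Literature.NumberTheory.Transcendental.CuspSlopeAlgebraic
import Literature.NumberTheory.Transcendental.BivariateBridge
import Literature.NumberTheory.Transcendental.CuspConstantAlgebraic

/-!
# Line `cusp-germ-schneider-sparsity` — skeleton for crux `RigidCore.SparsityTwo`
(item stmt-Schanuel-0971, route route-Schanuel-RigidCore)

crux-plan round 1 · planner-cruxplan-stmt-Schanuel-0971-cusp-germ-schneider--0 · idea card
`Cruxes/SparsityTwo/Ideas/cusp-germ-schneider-sparsity.md` (ideator 2; triage r1: pass ×3, sharpenings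
applied: junk-free `∃ᶠ` form of Theorem S, integer-exponent scope of Theorem R, retuned constants) ·
line card `Lines/cusp-germ-schneider-sparsity.md` · `lean check` rc 0, sorries only in the six `stub_*`.

LEAD STATUS (prover-line-stmt-Schanuel-0971-0, reshape 1, 2026-08-16): stubs (R) `stub_rationalJetRunge` and (Im)
`stub_nonRealJetFinite` LANDED (p72001, p72083; Im imported); (R) is superseded inside the composition by the stronger inline
`rationalJetShift_eventually_zero` (rational polynomial PLUS A CONSTANT), and (★)'s jet hypothesis sharpened accordingly;
(S) `stub_cuspZeroLogDensity` LANDED p74698 (Theorem S, Schneider's method with accumulation anchor); (H)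
`stub_classicalClassesFinite` LANDED p75576 (Hermite–Lindemann classes, no Baker); (E) `stub_cuspEscape` LANDED p77803 (geometry of
the place at infinity + Ax, over a 20-file Literature pipeline). ONLY OPEN STUB: (★) `stub_realArithmeticCuspFinite` (reshapes 2–3: fed
the proved algebraicity of the cusp values, of the linear slope and of the pure-jet constant) — the crux in normal form at one cusp;
`SparsityTwo_of` below is `SparsityTwo ⇐ ★`, kernel-checked. Provable sub-classes of (★) landed abstractly in Literature:
`QuadraticSlopeNormDescent` (p72764), `LiouvilleDepthFiniteness` (p72950); ANF infrastructure `AutStableVanishingDescent`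
(p72554), `CuspValueAlgebraic` (p72606). The text below is the planner's round-1 description (six stubs).

THE CRUX (as filed): every `W ⊆ ℂ² × ℂ²` defined over ℚ (`IsDefinedOver ⊥ W`) with `zariskiDim ℂ W < 2`
has only finitely many ℚ-linearly independent exponential points
(`indepExpPoints W = {x | LinearIndependent ℚ x ∧ (x, eˣ) ∈ W}`, tree `ExpPointsExamples`).

THE LINE. Infinitely many independent hits on a ℚ-curve accumulate at a place at infinity of a
component `C`; there the LEAF COORDINATES `F_j = (x_j − log y_j)/2πi` take INTEGER values at every hit.
(escape)   `stub_cuspEscape` — pure geometry + Ax: either (1) the place is LOG-FREE (both `y_j` finite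
           non-zero there) and, in the uniformizer `σ = F_i^{-1/e}` of the polar coordinate `x_i`, the hits on
           one of the `2e` rays are exactly the positive integers `N` at which ONE germ analytic at infinity,
           `h(N) = A(N^{1/e}) + g(N^{-1/e})` (`A ∈ ℂ[w]` the polar jet, `g` analytic at `0`, `g 0 = 0`,
           `g` TRANSCENDENTAL over `ℂ(z)`), takes an integer value — rotated/conjugated so that the ray is the
           positive real axis and `F_i = σ^{-e}` exactly; or (2) infinitely many independent hits lie on a
           DEGENERATE section `a x₁ + b x₂ = c`, `(a,b) ∈ ℤ² ∖ 0` (this absorbs every log-type end: the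
           meromorphic combination `m₂(x₁−ℓ₁) − m₁(x₂−ℓ₂)` is `2πiℤ`-valued at hits, a pole contradicts
           power-vs-log growth, no pole forces degeneracy — NO o-minimal / ModulusArcDichotomy input); or
           (3) infinitely many independent hits share the value `eˣ = ω` (constant-`y` components; with (2)
           this is where a non-transcendental germ lands, by Ax's theorem for one derivation, `n = 2`).
(classes)  `stub_classicalClassesFinite` — Hermite–Lindemann (tree `transcendental_exp_holds`,
           `transcendental_pi_holds`) kills (2) and (3) for EVERY `c`, `ω`: the only place ℚ-definedness is
           consumed outside the residual stub (the disprover's `expLineE` dies exactly here).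
(R)        `stub_rationalJetRunge` — a jet that is a rational polynomial in `N` with infinitely many integer
           points forces `g ≡ 0` near `0` (Runge / identity theorem), contradicting transcendence.
(Im)       `stub_nonRealJetFinite` — a jet or tail that is not REAL on the ray has finitely many integer
           points (integers are real; isolated zeros of a real-analytic germ).
(S)        `stub_cuspZeroLogDensity` — THEOREM S of the card, generalised to ramification `e` and jet degree
           `d`: for a transcendental tail the integer points have ZERO LOWER LOGARITHMIC DENSITY
           (`∀ ε > 0, ∃ᶠ X, #{N ≤ X : h N ∈ ℤ} ≤ ε log X`; Schneider's integer-valued-function method in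
           Waldschmidt's Pólya form, the pole supplying growth and the ACCUMULATION of hits at `σ = 0`
           supplying the identity theorem — no arithmetic of the coefficients, no anchor lower bound).
(★)        `stub_realArithmeticCuspFinite` — OPEN, the residual crux of the line: a REAL, period-twisted,
           transcendental cusp germ of a ℚ-curve with non-rational jet and a lacunary (zero lower
           log-density) integer-point set has finitely many integer points that are independent hits.

    SparsityTwo ⇐ by_contra (infinitely many independent hits)
      stub_cuspEscape ⇒ (1) ∨ (2) ∨ (3)
        (2), (3)  : stub_classicalClassesFinite                                     — contradiction
        (1)       : rational jet      → stub_rationalJetRunge ⇒ g ≡ 0 near 0 ⇒ ¬ transcendental (P = X₁)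
                    non-real jet/tail → stub_nonRealJetFinite ⇒ finitely many integer points
                    real, non-rational→ stub_cuspZeroLogDensity ⇒ lacunary ⇒ stub_realArithmeticCuspFinite
                                        ⇒ finitely many ray hits                    — contradiction.

`SparsityTwo_of_statements` is this composition, sorry-free (axioms propext / Classical.choice / Quot.sound),
over the six stub STATEMENTS (`type_of%`), concluding the crux unfolded (`indepExpPoints W` finite);
`SparsityTwo_of` applies it to the sorried stubs and concludes `RigidCore.SparsityTwo` BY NAME (the audited
skeleton theorem; hypotheses are admitted by the audit only by name, hence this split).

DISPROOF USED (cdisprove v1–v3.2; `run/gate/evidence/…/Disproof.lean` is NOT mounted in planner jails and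
`Cruxes/SparsityTwo/Disproof.lean` is not crux-written; read through the five evidence notes and the LANDED
companions `Literature.NumberTheory.Transcendental.{ExpPointsExamples, ZariskiDimBounds, ExpPointsShapiroModel}`):
no `_false_without_` theorem and no `Theorems/SparsityTwo/Negative/` lemma exists (nothing to import;
`ledger negatives --problem Schanuel`: two PolarPhantoms trdeg statements, unrelated). Honoured:
(i) `infinite_indepExpPoints_expLineE` (false without ℚ-definedness): the field-blind stubs (escape, R, Im, S)
never conclude finiteness of independent hits — escape only RELOCATES infinitude, R/Im/S speak of integer
points of a germ; ℚ-definedness is consumed in `stub_classicalClassesFinite` (ω = (1, e) ∉ ℚ̄² is exactly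
where expLineE fails) and in (★); (ii) `infinite_indepExpPoints_expPlaneQ` (dim < 3 fails): `zariskiDim < 2`
is a hypothesis of escape/classes/(★) and is used in escape to get CURVES; (iii)
`infinite_depExpPoints_expLineDep` (ℚ-independence necessary): expLineDep is disjunct (2) with `c = 0`,
where the class is EMPTY, and Theorem S is false without transcendence (`g ≡ 0` there) — its hypothesis;
(iv) calibration `transcendental_exp_real_of_sparsity`: `expLinesAlg` lands in disjunct (3) and
`stub_classicalClassesFinite` reproves real Hermite–Lindemann there, as the calibration demands;
(v) calibration `shapiroModel_finite_of_sparsity` (`shapiroW`, slope √2, torsion phase): inside (★), in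
its quadratic-slope sub-class, provable now by the bounded-norm argument (triage r1-1/2: Theorem-P class).
TRIAGE r1 answers: in the line card (`Triage answers:`); in short — S is stated junk-free (`∃ᶠ`, not
`liminf`), R is stated for jets that are rational polynomials in `N` (integer exponents), the reduction to
cusps is a STUB (escape) and turned out elementary + Ax (no ModulusFirst decl is leaned on), S's constants
are recorded for general `(e, d)`.
-/

namespace Summit.Schanuel.Schanuel.Cruxes.SparsityTwo.CuspGermSchneiderSparsity

open Filter Topology Complex Polynomial Literature.NumberTheory.Transcendental
open scoped Real

/-! ## Registered stubs (6)

Conventions shared by the statements (all inlined over tree declarations; no local definitions, so that the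
registered signatures are self-contained). A NORMALISED LOG-FREE CUSP RAY of `W` is the data
`s : Fin 2 ≃ Fin 2` (which coordinate is the polar-normalised one), `e ≥ 1` (ramification), `A : ℂ[w]`
(polar jet incl. constant term), `g ℓu ℓv : ℂ → ℂ` analytic at `0`, `g 0 = 0` (tail and the two local
logarithms of `y`), `ρ > 0`, with the punctured disc `0 < ‖σ‖ < ρ` mapped into `W` by
`σ ↦ (x, y) = ((2πi σ^{-e} + ℓu σ, 2πi (A(σ⁻¹) + g σ) + ℓv σ) ∘ s, (exp ℓu σ, exp ℓv σ) ∘ s)`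
— so the leaf coordinates are `F = σ^{-e}` and `F' = A(σ⁻¹) + g σ`. Its RAY POINTS are `σ_N = (w N)⁻¹`,
`w N := (N : ℝ) ^ (1/e : ℝ)` (so `σ_N^{-e} = N`), written out as
`x N = (2πi N + ℓu (w N)⁻¹, 2πi (A (w N) + g (w N)⁻¹) + ℓv (w N)⁻¹) ∘ s`, `y N = (exp ℓu (w N)⁻¹, exp ℓv (w N)⁻¹) ∘ s`,
and its RAY HITS are `{N | x N ∈ indepExpPoints W ∧ exp ∘ x N = y N ∧ ∃ L : ℤ, A (w N) + g (w N)⁻¹ = L}`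
(an independent hit of `W` that is the branch point at `σ_N`, with the germ value an integer).
`GermTranscendental g` is inlined as `¬ ∃ P : MvPolynomial (Fin 2) ℂ, P ≠ 0 ∧ ∀ᶠ z in 𝓝 0, P(z, g z) = 0`. -/

/-! `stub_cuspEscape` (E) — LANDED p77803 as
`Summits/Schanuel/Schanuel/Theorems/RigidCoreSparsityTwoCuspEscape.lean` (imported; same FQN), over the worker's Literature
pipeline (ZariskiDimCoordRelations, ExpCurveZeros, PuiseuxAtInfinity*, LaurentExpansion*, MeromorphicCurveGerms, BranchOrders,
RayGrowthContradiction, AxSchanuelTwoGerms, ExpPointsLogType{Pole,Regular}, ExpPointsLogFreeUniformize, ExpPointsCuspNormalForm,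
ExpPointsCuspTranscendence, ExpPointsCuspTrichotomy, ExpPointsCoordinateChange; p72400–p76878). The planner's statement and
proof plan are kept in the tree copy of the round-1 skeleton (Lines/cusp-germ-schneider-sparsity.lean history) and in that file. -/

/-! ### (E) inlined verbatim from the landed file (temporary: the farm snapshot does not yet serve the new Theorems module;
the assembled Theorems file will `import` it instead). -/

/-- The trichotomy when the FIRST coordinate is unbounded on the independent hits. -/
theorem cuspEscape_of_unbounded_fst (W : Set (Fin 2 ⊕ Fin 2 → ℂ))
    (hW : IsDefinedOver (⊥ : Subfield ℂ) W) (hdim : zariskiDim ℂ W < 2)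
    (h0 : ∀ R : ℝ, Set.Infinite {x : Fin 2 → ℂ | x ∈ indepExpPoints W ∧ R < ‖x 0‖}) :
    (∃ (s : Fin 2 ≃ Fin 2) (e : ℕ) (A : Polynomial ℂ) (g ℓu ℓv : ℂ → ℂ) (ρ : ℝ),
        let w : ℕ → ℂ := fun N => (((N : ℝ) ^ ((e : ℝ)⁻¹) : ℝ) : ℂ);
        let x : ℕ → Fin 2 → ℂ := fun N =>
          (![2 * ↑π * I * (N : ℂ) + ℓu (w N)⁻¹,
              2 * ↑π * I * (A.eval (w N) + g (w N)⁻¹) + ℓv (w N)⁻¹] : Fin 2 → ℂ) ∘ s;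
        let y : ℕ → Fin 2 → ℂ := fun N =>
          (![Complex.exp (ℓu (w N)⁻¹), Complex.exp (ℓv (w N)⁻¹)] : Fin 2 → ℂ) ∘ s;
        0 < e ∧ 0 < ρ ∧ AnalyticAt ℂ g 0 ∧ g 0 = 0 ∧ AnalyticAt ℂ ℓu 0 ∧ AnalyticAt ℂ ℓv 0 ∧
        (¬ ∃ P : MvPolynomial (Fin 2) ℂ, P ≠ 0 ∧
            ∀ᶠ z in 𝓝 (0 : ℂ), MvPolynomial.eval ![z, g z] P = 0) ∧
        (∀ σ : ℂ, 0 < ‖σ‖ → ‖σ‖ < ρ →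
          Sum.elim ((![2 * ↑π * I * σ⁻¹ ^ e + ℓu σ,
                        2 * ↑π * I * (A.eval σ⁻¹ + g σ) + ℓv σ] : Fin 2 → ℂ) ∘ s)
            ((![Complex.exp (ℓu σ), Complex.exp (ℓv σ)] : Fin 2 → ℂ) ∘ s) ∈ W) ∧
        Set.Infinite {N : ℕ | x N ∈ indepExpPoints W ∧ Complex.exp ∘ x N = y N ∧
          ∃ L : ℤ, A.eval (w N) + g (w N)⁻¹ = L}) ∨
      (∃ a b : ℤ, (a ≠ 0 ∨ b ≠ 0) ∧ ∃ c : ℂ,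
        Set.Infinite {x : Fin 2 → ℂ | x ∈ indepExpPoints W ∧ (a : ℂ) * x 0 + (b : ℂ) * x 1 = c}) ∨
      (∃ ω : Fin 2 → ℂ,
        Set.Infinite {x : Fin 2 → ℂ | x ∈ indepExpPoints W ∧ Complex.exp ∘ x = ω}) := by
  obtain ⟨e, he, N, r, hr, Φ₁, Φ₂, Φ₃, hana, hWb, hhit⟩ :=
    exists_branch_through_hits hW.isZariskiClosed hdim (T := indepExpPoints W) subset_rfl h0
  exact cusp_trichotomy hW hdim he hr hana hWb hhit

/-- **stub_cuspEscape** (E): the geometric escape trichotomy. For `W ⊆ ℂ² × ℂ²` defined over `ℚ`,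
of Zariski dimension `< 2`, with infinitely many `ℚ`-linearly independent exponential points, one of:
(1) a normalised log-free cusp ray of `W` with transcendental tail carries infinitely many ray hits;
(2) a degenerate section `a x₀ + b x₁ = c`, `(a, b) ∈ ℤ² ∖ 0`, carries infinitely many independent
hits; (3) a fibre `eˣ = ω` carries infinitely many independent hits. -/
theorem stub_cuspEscape :
    ∀ (W : Set (Fin 2 ⊕ Fin 2 → ℂ)), IsDefinedOver (⊥ : Subfield ℂ) W → zariskiDim ℂ W < 2 →
      (indepExpPoints W).Infinite →
      (∃ (s : Fin 2 ≃ Fin 2) (e : ℕ) (A : Polynomial ℂ) (g ℓu ℓv : ℂ → ℂ) (ρ : ℝ),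
        let w : ℕ → ℂ := fun N => (((N : ℝ) ^ ((e : ℝ)⁻¹) : ℝ) : ℂ);
        let x : ℕ → Fin 2 → ℂ := fun N =>
          (![2 * ↑π * I * (N : ℂ) + ℓu (w N)⁻¹,
              2 * ↑π * I * (A.eval (w N) + g (w N)⁻¹) + ℓv (w N)⁻¹] : Fin 2 → ℂ) ∘ s;
        let y : ℕ → Fin 2 → ℂ := fun N =>
          (![Complex.exp (ℓu (w N)⁻¹), Complex.exp (ℓv (w N)⁻¹)] : Fin 2 → ℂ) ∘ s;
        0 < e ∧ 0 < ρ ∧ AnalyticAt ℂ g 0 ∧ g 0 = 0 ∧ AnalyticAt ℂ ℓu 0 ∧ AnalyticAt ℂ ℓv 0 ∧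
        (¬ ∃ P : MvPolynomial (Fin 2) ℂ, P ≠ 0 ∧
            ∀ᶠ z in 𝓝 (0 : ℂ), MvPolynomial.eval ![z, g z] P = 0) ∧
        (∀ σ : ℂ, 0 < ‖σ‖ → ‖σ‖ < ρ →
          Sum.elim ((![2 * ↑π * I * σ⁻¹ ^ e + ℓu σ,
                        2 * ↑π * I * (A.eval σ⁻¹ + g σ) + ℓv σ] : Fin 2 → ℂ) ∘ s)
            ((![Complex.exp (ℓu σ), Complex.exp (ℓv σ)] : Fin 2 → ℂ) ∘ s) ∈ W) ∧
        Set.Infinite {N : ℕ | x N ∈ indepExpPoints W ∧ Complex.exp ∘ x N = y N ∧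
          ∃ L : ℤ, A.eval (w N) + g (w N)⁻¹ = L}) ∨
      (∃ a b : ℤ, (a ≠ 0 ∨ b ≠ 0) ∧ ∃ c : ℂ,
        Set.Infinite {x : Fin 2 → ℂ | x ∈ indepExpPoints W ∧ (a : ℂ) * x 0 + (b : ℂ) * x 1 = c}) ∨
      (∃ ω : Fin 2 → ℂ,
        Set.Infinite {x : Fin 2 → ℂ | x ∈ indepExpPoints W ∧ Complex.exp ∘ x = ω}) := by
  intro W hW hdim hinf
  obtain ⟨i, hi⟩ := exists_unbounded_coord hdim hinf
  fin_cases i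
  · exact cuspEscape_of_unbounded_fst W hW hdim hi
  -- the second coordinate is unbounded: swap both coordinate blocks
  set σ : Fin 2 ≃ Fin 2 := Equiv.swap 0 1 with hσ
  set W' : Set (Fin 2 ⊕ Fin 2 → ℂ) := {z | z ∘ ⇑(Equiv.sumCongr σ σ) ∈ W} with hW'def
  have hW' : IsDefinedOver (⊥ : Subfield ℂ) W' := isDefinedOver_comp_equiv hW _
  have hdim' : zariskiDim ℂ W' < 2 := by rw [hW'def, zariskiDim_comp_equiv]; exact hdim
  have hss : ∀ z : Fin 2 → ℂ, (z ∘ σ) ∘ σ = z := fun z => by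
    funext j; fin_cases j <;> simp [hσ]
  have hinj : Function.Injective fun x : Fin 2 → ℂ => x ∘ σ := fun x y hxy => by
    have := congrArg (fun f : Fin 2 → ℂ => f ∘ σ) hxy
    simpa only [hss] using this
  have hmem : ∀ x : Fin 2 → ℂ, x ∈ indepExpPoints W → x ∘ σ ∈ indepExpPoints W' := by
    intro x hx
    rw [mem_indepExpPoints_comp_swap, hss]
    exact hx
  have h0' : ∀ R : ℝ, Set.Infinite {x : Fin 2 → ℂ | x ∈ indepExpPoints W' ∧ R < ‖x 0‖} := by
    intro R
    refine ((hi R).image hinj.injOn).mono ?_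
    rintro _ ⟨x, ⟨hxH, hxR⟩, rfl⟩
    exact ⟨hmem x hxH, by simpa [hσ] using hxR⟩
  rcases cuspEscape_of_unbounded_fst W' hW' hdim' h0' with h1 | h2 | h3
  · -- (1): compose the coordinate choice with the swap
    obtain ⟨s, e, A, g, ℓu, ℓv, ρ, he, hρ, hg, hg0, hℓu, hℓv, htr, hbr, hN⟩ := h1
    refine Or.inl ⟨σ.trans s, e, A, g, ℓu, ℓv, ρ, ?_⟩
    intro w x y
    refine ⟨he, hρ, hg, hg0, hℓu, hℓv, htr, fun τ hτ0 hτρ => ?_, ?_⟩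
    · have := hbr τ hτ0 hτρ
      rw [hW'def, Set.mem_setOf_eq, sumElim_comp_sumCongr] at this
      simpa only [Equiv.coe_trans, Function.comp_assoc] using this
    · simp only [w, x, y]
      refine hN.mono ?_
      rintro n ⟨hH, hexp, hL⟩
      refine ⟨?_, ?_, hL⟩
      · have := (mem_indepExpPoints_comp_swap σ).1 hH
        simpa only [Equiv.coe_trans, Function.comp_assoc] using this
      · have := congrArg (fun f : Fin 2 → ℂ => f ∘ σ) hexp
        simpa only [Equiv.coe_trans, Function.comp_assoc] using this
  · -- (2): the swapped section
    obtain ⟨a, b, hab, c, hinf2⟩ := h2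
    refine Or.inr (Or.inl ⟨b, a, hab.symm, c, ((hinf2.image hinj.injOn)).mono ?_⟩)
    rintro _ ⟨x, ⟨hxH, hxc⟩, rfl⟩
    refine ⟨(mem_indepExpPoints_comp_swap σ).1 hxH, ?_⟩
    simp only [Function.comp_apply, hσ, Equiv.swap_apply_left, Equiv.swap_apply_right]
    rw [← hxc]; ring
  · -- (3): the swapped fibre
    obtain ⟨ω, hinf3⟩ := h3
    refine Or.inr (Or.inr ⟨ω ∘ σ, (hinf3.image hinj.injOn).mono ?_⟩)
    rintro _ ⟨x, ⟨hxH, hxω⟩, rfl⟩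
    refine ⟨(mem_indepExpPoints_comp_swap σ).1 hxH, ?_⟩
    show (Complex.exp ∘ x) ∘ σ = ω ∘ σ
    rw [hxω]

/-! `stub_classicalClassesFinite` (H) — LANDED p75576 as
`Summits/Schanuel/Schanuel/Theorems/RigidCoreSparsityTwoClassicalClassesFinite.lean` (imported; same FQN), over the new tree
theorems `finite_indepExpPoints_section` (ExpPointsDegenerateSections, p74284) and `finite_indepExpPoints_fibre`
(ExpPointsConstantExponential, p75179): Hermite–Lindemann + Lindemann only, no Baker. -/

/-! `stub_rationalJetRunge` (R) — LANDED p72001 as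
`Summits/Schanuel/Schanuel/Theorems/RigidCoreSparsityTwoRationalJetRunge.lean`; superseded inside the
composition by the shifted form `rationalJetShift_eventually_zero` proved below (reshape 1). -/

/-! `stub_nonRealJetFinite` (Im) — LANDED p72083 as
`Summits/Schanuel/Schanuel/Theorems/RigidCoreSparsityTwoNonRealJetFinite.lean` (imported; same FQN). -/

/-! `stub_cuspZeroLogDensity` (S) — LANDED p74698 as
`Summits/Schanuel/Schanuel/Theorems/RigidCoreSparsityTwoCuspZeroLogDensity.lean` (imported; same FQN), over the new tree
theorem `Literature.NumberTheory.Transcendental.frequently_card_le_mul_log` (SchneiderCuspGerm.lean, p74233). -/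

/-- **stub_realArithmeticCuspFinite** (★) — OPEN: THE RESIDUAL CRUX OF THE LINE (hardest stub). A normalised
log-free cusp ray of a ℚ-closed `W` of dimension `< 2` whose tail `g` is transcendental, whose jet is NOT a
rational polynomial in `N` plus a complex constant (lead's reshape 1, 2026-08-16: the shifted Runge lemma
`rationalJetShift_eventually_zero` kills that class too), whose cusp values `e^{ℓu 0}`, `e^{ℓv 0}` and (for
`deg A ≤ e`) slope `A.coeff e` are ALGEBRAIC (lead's reshape 2: `cusp_values_isAlgebraic`,
`cusp_slope_isAlgebraic`, proved) and whose pure-jet constant `2πi a₀ + ℓv 0 − β ℓu 0` is ALGEBRAIC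
(lead's reshape 3: `cusp_constant_isAlgebraic`, proved), which is REAL on the ray (`A ∈ ℝ[w]`, `Im g = 0` on `(0, δ)`: the τ₀-symmetric
situation; every non-real ray died in (Im)), and whose integer points are LACUNARY (zero lower log-density,
supplied by (S)), carries only finitely many ray hits (independent hits of `W` sitting at `σ_N` with an
integer germ value). This is `SparsityTwo` at one cusp in normal form, with three unconditional reductions
already cashed; it is implied by the crux (the map `N ↦ x N` is finite-to-one: `‖x N‖ ≥ 2πN − O(1)`), hence
SC(2)-implied and not cheaply refutable. CONTENT a proof must supply, in order:
(a) ARITHMETIC NORMAL FORM (provable now, the first `--supports` lemma): from `IsDefinedOver ⊥ W` and the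
branch, `A` and the Taylor coefficients of `g, ℓu, ℓv` lie in `ℚ̄[2πi, (2πi)⁻¹]` with the period grading
`c_m = a_m (2πi)^{-m-1}`, `a_m ∈ K := ℚ̄(C)`-residue field data of G-type growth (Puiseux over ℚ̄ + Eisenstein;
benchmark: `h(K) = βK + (2−β)/(2π²K) + (4−5β)/(24π⁴K³) + …`, confirmed to 2 orders by three triage jobs
j007047/j007059/j007079 and the ideator's j006232); reality then forces the UNITARY shape `|e^{ℓ(0)}| = 1`
up to the Gel'fond–Schneider-type step of ModulusFirst's `SymmetricAlgebraicIsUnitary` (4151).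
(b) PROVABLE SUB-CLASSES (each a `--supports` lemma, levers of the sibling cards apply verbatim to this
germ): linear cusps `A = βw^e + a₀` with real-quadratic `β` (bounded norm `(βK − L)(β'K − L)`, Theorem P =
`PellOrbitShapiro.QuadraticSlopeFiniteness` 7106 — contains the disprover's calibration `shapiroW`);
depth `≥ deg β` (Liouville, Mathlib `Liouville.exists_pos_real_of_irrational_root`; e.g. the balanced `∛2`
curve, depth 3) and depth `≥ 2` given Roth; vanishing-coefficient / norm-descent classes (card
galois-norm-branch-defect); exact-chain polynomial twists (card function-field-heights, `ExactChainMonomialTwistFinite`).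
(c) THE ATOMS (open): depth-1 linear cusps with `[ℚ(β):ℚ] ≥ 3` or non-torsion phases (simultaneous
approximation of `(β, ℚ(β)ˣ·π⁻²)`), non-linear ends with transcendental leading coefficient `2π·Q(N)`
(Weyl-polynomial targets), two-inexact-chain Shapiro pairs. The card's bet for (c): Schneider's scheme of
(S) run again with the G-type DENOMINATORS of the `a_m` fed into the cusp Taylor conditions (Gel'fond-style
high-order vanishing at `σ = 0`, linear conditions split along powers of the period), using the lacunarity
(S) provides; the ideator could NOT close this parameter count (the period twist multiplies the cusp
conditions by the π-degree) — filed as the open step, not as a claim.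
Why it might fail (as a programme, not as a statement): integrality + analyticity + lacunarity alone cannot
give finiteness (Newton interpolation along `K_{n+1} ≍ ∏ K_j` builds transcendental REAL germs with
`≍ log log X` integer points — so (a)'s arithmetic is genuinely load-bearing), and for cubic `β` the
depth-1 atom is a Littlewood-type simultaneous approximation problem.
Leans on: everything above + `baker_holds`, `gelfond_schneider_holds`, `transcendental_pi_holds` (tree,
PROVED); Roth / quantitative Baker–Wüstholz are NOT in tree (cite-facts, only for sub-classes of (b)). -/
theorem stub_realArithmeticCuspFinite :
    ∀ (W : Set (Fin 2 ⊕ Fin 2 → ℂ)), IsDefinedOver (⊥ : Subfield ℂ) W → zariskiDim ℂ W < 2 →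
      ∀ (s : Fin 2 ≃ Fin 2) (e : ℕ) (A : Polynomial ℂ) (g ℓu ℓv : ℂ → ℂ) (ρ : ℝ),
        let w : ℕ → ℂ := fun N => (((N : ℝ) ^ ((e : ℝ)⁻¹) : ℝ) : ℂ);
        let x : ℕ → Fin 2 → ℂ := fun N =>
          (![2 * ↑π * I * (N : ℂ) + ℓu (w N)⁻¹,
              2 * ↑π * I * (A.eval (w N) + g (w N)⁻¹) + ℓv (w N)⁻¹] : Fin 2 → ℂ) ∘ s;
        let y : ℕ → Fin 2 → ℂ := fun N =>
          (![Complex.exp (ℓu (w N)⁻¹), Complex.exp (ℓv (w N)⁻¹)] : Fin 2 → ℂ) ∘ s;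
        0 < e → 0 < ρ → AnalyticAt ℂ g 0 → g 0 = 0 → AnalyticAt ℂ ℓu 0 → AnalyticAt ℂ ℓv 0 →
        (¬ ∃ P : MvPolynomial (Fin 2) ℂ, P ≠ 0 ∧
            ∀ᶠ z in 𝓝 (0 : ℂ), MvPolynomial.eval ![z, g z] P = 0) →
        (∀ σ : ℂ, 0 < ‖σ‖ → ‖σ‖ < ρ →
          Sum.elim ((![2 * ↑π * I * σ⁻¹ ^ e + ℓu σ,
                        2 * ↑π * I * (A.eval σ⁻¹ + g σ) + ℓv σ] : Fin 2 → ℂ) ∘ s)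
            ((![Complex.exp (ℓu σ), Complex.exp (ℓv σ)] : Fin 2 → ℂ) ∘ s) ∈ W) →
        (¬ ∃ (q : Polynomial ℚ) (c : ℂ), ∀ N : ℕ,
            A.eval (w N) = (q.map (algebraMap ℚ ℂ)).eval (N : ℂ) + c) →
        ((∀ k : ℕ, (A.coeff k).im = 0) ∧ ∀ᶠ t : ℝ in 𝓝[>] 0, (g (t : ℂ)).im = 0) →
        (∀ ε : ℝ, 0 < ε → ∃ᶠ X : ℕ in atTop,
          (Nat.card {N : ℕ | N ≤ X ∧ ∃ L : ℤ, A.eval (w N) + g (w N)⁻¹ = L} : ℝ)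
            ≤ ε * Real.log X) →
        IsAlgebraic ℚ (Complex.exp (ℓu 0)) → IsAlgebraic ℚ (Complex.exp (ℓv 0)) →
        (A.natDegree ≤ e → IsAlgebraic ℚ (A.coeff e)) →
        (A.natDegree ≤ e → (∀ k, 0 < k → k < e → A.coeff k = 0) →
          IsAlgebraic ℚ (2 * ↑π * I * A.coeff 0 + ℓv 0 - A.coeff e * ℓu 0)) →
        Set.Finite {N : ℕ | x N ∈ indepExpPoints W ∧ Complex.exp ∘ x N = y N ∧
          ∃ L : ℤ, A.eval (w N) + g (w N)⁻¹ = L} := by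
  sorry

/-! ## Lead's reshape 2: the first ARITHMETIC data of a cusp ray are algebraic (proved)

The values `e^{ℓu 0}`, `e^{ℓv 0}` of the exponential coordinates at the cusp, and the slope `A.coeff e` of a
linear cusp (`deg A ≤ e`), are algebraic numbers — from the RATIONAL pair relations on the ℚ-variety `W`
(`RationalCoordRelations`, `BivariateBridge`) and the asymptotic lemmas `CuspValueAlgebraic` / `CuspSlopeAlgebraic`.
The composition feeds them to the residual stub (★) as hypotheses. -/

/-- **Cusp values are algebraic.** On a normalised log-free cusp ray of a ℚ-closed `W` of dimension
`< 2` (the data of the residual stub (★)), the values `e^{ℓu 0}`, `e^{ℓv 0}` of the two exponential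
coordinates at the cusp are algebraic numbers: the polar coordinate `x_i = 2πiσ^{-e} + ℓu σ` is
unbounded as `σ → 0` while `y = (e^{ℓu σ}, e^{ℓv σ})` converges, and each pair `(x_i, y_j)` satisfies
a nonzero RATIONAL relation on `W` (`exists_rat_relation_pair_of_zariskiDim_lt_two`), whose top
coefficient must vanish at the limit (`isAlgebraic_of_tendsto_of_eval₂_eq_zero`). First arithmetic
datum of the normal form of (★). -/
theorem cusp_values_isAlgebraic
    (W : Set (Fin 2 ⊕ Fin 2 → ℂ)) (hW : IsDefinedOver (⊥ : Subfield ℂ) W) (hdim : zariskiDim ℂ W < 2)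
    (s : Fin 2 ≃ Fin 2) (e : ℕ) (A : Polynomial ℂ) (g ℓu ℓv : ℂ → ℂ) (ρ : ℝ)
    (he : 0 < e) (hρ : 0 < ρ) (hu : AnalyticAt ℂ ℓu 0) (hv : AnalyticAt ℂ ℓv 0)
    (hbr : ∀ σ : ℂ, 0 < ‖σ‖ → ‖σ‖ < ρ →
      Sum.elim ((![2 * ↑π * I * σ⁻¹ ^ e + ℓu σ,
                    2 * ↑π * I * (A.eval σ⁻¹ + g σ) + ℓv σ] : Fin 2 → ℂ) ∘ s)
        ((![Complex.exp (ℓu σ), Complex.exp (ℓv σ)] : Fin 2 → ℂ) ∘ s) ∈ W) :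
    IsAlgebraic ℚ (Complex.exp (ℓu 0)) ∧ IsAlgebraic ℚ (Complex.exp (ℓv 0)) := by
  -- the sample points `σ_n = ρ/(n+2)` in the punctured disc
  set σ : ℕ → ℂ := fun n => ((ρ / ((n : ℝ) + 2) : ℝ) : ℂ) with hσ
  have hσnorm : ∀ n, ‖σ n‖ = ρ / ((n : ℝ) + 2) := fun n => by
    rw [hσ]; simp only [Complex.norm_real, Real.norm_eq_abs]
    exact abs_of_pos (by positivity)
  have hσpos : ∀ n, 0 < ‖σ n‖ := fun n => by rw [hσnorm]; positivity
  have hσlt : ∀ n, ‖σ n‖ < ρ := fun n => by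
    rw [hσnorm, div_lt_iff₀ (by positivity)]
    nlinarith
  have hσne : ∀ n, σ n ≠ 0 := fun n => norm_pos_iff.mp (hσpos n)
  have hσlim : Tendsto σ atTop (𝓝 0) := by
    have h0 : Tendsto (fun n => ‖σ n‖) atTop (𝓝 0) := by
      have h1 : Tendsto (fun n : ℕ => ρ / ((n : ℝ) + 2)) atTop (𝓝 0) := by
        have := (tendsto_const_div_atTop_nhds_zero_nat ρ).comp (tendsto_add_atTop_nat 2)
        refine this.congr fun n => ?_
        simp only [Function.comp_apply, Nat.cast_add, Nat.cast_ofNat]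
      exact h1.congr fun n => (hσnorm n).symm
    exact tendsto_zero_iff_norm_tendsto_zero.mpr h0
  -- the polar coordinate `u n = 2πi σ_n^{-e} + ℓu σ_n` is unbounded
  set u : ℕ → ℂ := fun n => 2 * ↑π * I * (σ n)⁻¹ ^ e + ℓu (σ n) with hudef
  have hℓu : Tendsto (fun n => ℓu (σ n)) atTop (𝓝 (ℓu 0)) :=
    (hu.continuousAt.tendsto).comp hσlim
  have hℓv : Tendsto (fun n => ℓv (σ n)) atTop (𝓝 (ℓv 0)) :=
    (hv.continuousAt.tendsto).comp hσlim
  have hularge : Tendsto (fun n => ‖u n‖) atTop atTop := by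
    -- main term: `‖2πi σ_n^{-e}‖ = 2π ((n+2)/ρ)^e → ∞`
    have hmain : Tendsto (fun n => ‖2 * ↑π * I * (σ n)⁻¹ ^ e‖) atTop atTop := by
      have h1 : Tendsto (fun n : ℕ => ((n : ℝ) + 2) / ρ) atTop atTop :=
        Tendsto.atTop_div_const hρ (tendsto_natCast_atTop_atTop.atTop_add tendsto_const_nhds)
      have h2 : Tendsto (fun n : ℕ => (2 * π) * (((n : ℝ) + 2) / ρ) ^ e) atTop atTop :=
        Tendsto.const_mul_atTop (by positivity) ((tendsto_pow_atTop he.ne') |>.comp h1)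
      refine h2.congr fun n => ?_
      rw [norm_mul, norm_mul, norm_mul, norm_pow, norm_inv, hσnorm n, Complex.norm_I,
        Complex.norm_real, Real.norm_eq_abs, abs_of_pos Real.pi_pos, inv_div]
      norm_num
    -- bounded perturbation
    have hbd : ∀ᶠ n in atTop, ‖ℓu (σ n)‖ ≤ ‖ℓu 0‖ + 1 := by
      have := hℓu.norm
      exact (this.eventually (gt_mem_nhds (lt_add_one _))).mono fun n hn => hn.le
    have hlow : ∀ᶠ n in atTop, ‖2 * ↑π * I * (σ n)⁻¹ ^ e‖ - (‖ℓu 0‖ + 1) ≤ ‖u n‖ := by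
      filter_upwards [hbd] with n hn
      have : ‖2 * ↑π * I * (σ n)⁻¹ ^ e‖ ≤ ‖u n‖ + ‖ℓu (σ n)‖ := by
        have h := norm_add_le (u n) (-ℓu (σ n))
        have huv : u n + -ℓu (σ n) = 2 * ↑π * I * (σ n)⁻¹ ^ e := by rw [hudef]; ring
        rw [huv, norm_neg] at h
        exact h
      linarith
    refine tendsto_atTop_mono' atTop hlow ?_
    exact tendsto_atTop_add_const_right _ _ hmain
  -- the rational relations between the polar coordinate and each exponential coordinate
  have hcoord : ∀ (z : ℂ) , ∀ j : Fin 2,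
      (Sum.elim ((![2 * ↑π * I * z⁻¹ ^ e + ℓu z,
                    2 * ↑π * I * (A.eval z⁻¹ + g z) + ℓv z] : Fin 2 → ℂ) ∘ s)
        ((![Complex.exp (ℓu z), Complex.exp (ℓv z)] : Fin 2 → ℂ) ∘ s) : Fin 2 ⊕ Fin 2 → ℂ)
          (Sum.inl (s.symm 0)) = 2 * ↑π * I * z⁻¹ ^ e + ℓu z ∧
      (Sum.elim ((![2 * ↑π * I * z⁻¹ ^ e + ℓu z,
                    2 * ↑π * I * (A.eval z⁻¹ + g z) + ℓv z] : Fin 2 → ℂ) ∘ s)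
        ((![Complex.exp (ℓu z), Complex.exp (ℓv z)] : Fin 2 → ℂ) ∘ s) : Fin 2 ⊕ Fin 2 → ℂ)
          (Sum.inr (s.symm j)) = (![Complex.exp (ℓu z), Complex.exp (ℓv z)] : Fin 2 → ℂ) j := by
    intro z j
    constructor
    · simp
    · simp
  have key : ∀ j : Fin 2, IsAlgebraic ℚ ((![Complex.exp (ℓu 0), Complex.exp (ℓv 0)] : Fin 2 → ℂ) j) := by
    intro j
    obtain ⟨R, hR0, hRW⟩ := exists_rat_relation_pair_of_zariskiDim_lt_two W hW hdim
      (Sum.inl (s.symm 0)) (Sum.inr (s.symm j))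
    obtain ⟨Q, hQ0, hQ⟩ := exists_bivariate_of_mvPolynomial R hR0
    set v : ℕ → ℂ := fun n => (![Complex.exp (ℓu (σ n)), Complex.exp (ℓv (σ n))] : Fin 2 → ℂ) j
      with hvdef
    have hvlim : Tendsto v atTop
        (𝓝 ((![Complex.exp (ℓu 0), Complex.exp (ℓv 0)] : Fin 2 → ℂ) j)) := by
      fin_cases j
      · simpa [hvdef, Function.comp_def] using (Complex.continuous_exp.tendsto _).comp hℓu
      · simpa [hvdef, Function.comp_def] using (Complex.continuous_exp.tendsto _).comp hℓv
    refine isAlgebraic_of_tendsto_of_eval₂_eq_zero Q hQ0 hularge hvlim fun n => ?_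
    rw [hQ]
    have hz := hRW _ (hbr (σ n) (hσpos n) (hσlt n))
    rw [(hcoord (σ n) j).1, (hcoord (σ n) j).2] at hz
    exact hz
  exact ⟨key 0, key 1⟩


/-- **The slope of a linear cusp is algebraic.** On a normalised log-free cusp ray of a ℚ-closed `W`
of dimension `< 2` with jet `A` of degree `≤ e` (so that `x_{i'}/x_i → A.coeff e`), the slope
`A.coeff e` is an algebraic number (`CuspSlopeAlgebraic` applied to the rational relation between the
two additive coordinates). For `deg A < e` the statement is empty (`A.coeff e = 0`). -/
theorem cusp_slope_isAlgebraic
    (W : Set (Fin 2 ⊕ Fin 2 → ℂ)) (hW : IsDefinedOver (⊥ : Subfield ℂ) W) (hdim : zariskiDim ℂ W < 2)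
    (s : Fin 2 ≃ Fin 2) (e : ℕ) (A : Polynomial ℂ) (g ℓu ℓv : ℂ → ℂ) (ρ : ℝ)
    (he : 0 < e) (hρ : 0 < ρ) (hg : AnalyticAt ℂ g 0) (hg0 : g 0 = 0)
    (hu : AnalyticAt ℂ ℓu 0) (hv : AnalyticAt ℂ ℓv 0)
    (hbr : ∀ σ : ℂ, 0 < ‖σ‖ → ‖σ‖ < ρ →
      Sum.elim ((![2 * ↑π * I * σ⁻¹ ^ e + ℓu σ,
                    2 * ↑π * I * (A.eval σ⁻¹ + g σ) + ℓv σ] : Fin 2 → ℂ) ∘ s)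
        ((![Complex.exp (ℓu σ), Complex.exp (ℓv σ)] : Fin 2 → ℂ) ∘ s) ∈ W)
    (hdeg : A.natDegree ≤ e) :
    IsAlgebraic ℚ (A.coeff e) := by
  -- the sample points `σ_n = ρ/(n+2)` in the punctured disc
  set σ : ℕ → ℂ := fun n => ((ρ / ((n : ℝ) + 2) : ℝ) : ℂ) with hσ
  have hσnorm : ∀ n, ‖σ n‖ = ρ / ((n : ℝ) + 2) := fun n => by
    rw [hσ]; simp only [Complex.norm_real, Real.norm_eq_abs]
    exact abs_of_pos (by positivity)
  have hσpos : ∀ n, 0 < ‖σ n‖ := fun n => by rw [hσnorm]; positivity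
  have hσlt : ∀ n, ‖σ n‖ < ρ := fun n => by
    rw [hσnorm, div_lt_iff₀ (by positivity)]
    nlinarith
  have hσne : ∀ n, σ n ≠ 0 := fun n => norm_pos_iff.mp (hσpos n)
  have hσlim : Tendsto σ atTop (𝓝 0) := by
    have h0 : Tendsto (fun n => ‖σ n‖) atTop (𝓝 0) := by
      have h1 : Tendsto (fun n : ℕ => ρ / ((n : ℝ) + 2)) atTop (𝓝 0) := by
        have := (tendsto_const_div_atTop_nhds_zero_nat ρ).comp (tendsto_add_atTop_nat 2)
        refine this.congr fun n => ?_
        simp only [Function.comp_apply, Nat.cast_add, Nat.cast_ofNat]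
      exact h1.congr fun n => (hσnorm n).symm
    exact tendsto_zero_iff_norm_tendsto_zero.mpr h0
  have hℓu : Tendsto (fun n => ℓu (σ n)) atTop (𝓝 (ℓu 0)) :=
    (hu.continuousAt.tendsto).comp hσlim
  have hℓv : Tendsto (fun n => ℓv (σ n)) atTop (𝓝 (ℓv 0)) :=
    (hv.continuousAt.tendsto).comp hσlim
  have hgl : Tendsto (fun n => g (σ n)) atTop (𝓝 0) := by
    have := (hg.continuousAt.tendsto).comp hσlim
    rwa [hg0] at this
  have hpow : Tendsto (fun n => (σ n) ^ e) atTop (𝓝 0) := by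
    have := hσlim.pow e
    rwa [zero_pow he.ne'] at this
  -- the two additive coordinates along `σ n`
  set u : ℕ → ℂ := fun n => 2 * ↑π * I * (σ n)⁻¹ ^ e + ℓu (σ n) with hudef
  set v : ℕ → ℂ := fun n => 2 * ↑π * I * (A.eval (σ n)⁻¹ + g (σ n)) + ℓv (σ n) with hvdef
  -- `u` is unbounded (as in `cusp_values_isAlgebraic`)
  have hularge : Tendsto (fun n => ‖u n‖) atTop atTop := by
    have hmain : Tendsto (fun n => ‖2 * ↑π * I * (σ n)⁻¹ ^ e‖) atTop atTop := by
      have h1 : Tendsto (fun n : ℕ => ((n : ℝ) + 2) / ρ) atTop atTop :=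
        Tendsto.atTop_div_const hρ (tendsto_natCast_atTop_atTop.atTop_add tendsto_const_nhds)
      have h2 : Tendsto (fun n : ℕ => (2 * π) * (((n : ℝ) + 2) / ρ) ^ e) atTop atTop :=
        Tendsto.const_mul_atTop (by positivity) ((tendsto_pow_atTop he.ne') |>.comp h1)
      refine h2.congr fun n => ?_
      rw [norm_mul, norm_mul, norm_mul, norm_pow, norm_inv, hσnorm n, Complex.norm_I,
        Complex.norm_real, Real.norm_eq_abs, abs_of_pos Real.pi_pos, inv_div]
      norm_num
    have hbd : ∀ᶠ n in atTop, ‖ℓu (σ n)‖ ≤ ‖ℓu 0‖ + 1 := by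
      have := hℓu.norm
      exact (this.eventually (gt_mem_nhds (lt_add_one _))).mono fun n hn => hn.le
    have hlow : ∀ᶠ n in atTop, ‖2 * ↑π * I * (σ n)⁻¹ ^ e‖ - (‖ℓu 0‖ + 1) ≤ ‖u n‖ := by
      filter_upwards [hbd] with n hn
      have : ‖2 * ↑π * I * (σ n)⁻¹ ^ e‖ ≤ ‖u n‖ + ‖ℓu (σ n)‖ := by
        have h := norm_add_le (u n) (-ℓu (σ n))
        have huv : u n + -ℓu (σ n) = 2 * ↑π * I * (σ n)⁻¹ ^ e := by rw [hudef]; ring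
        rw [huv, norm_neg] at h
        exact h
      linarith
    refine tendsto_atTop_mono' atTop hlow ?_
    exact tendsto_atTop_add_const_right _ _ hmain
  -- the ratio `v/u → A.coeff e`
  have hf : Tendsto (fun n => (σ n) ^ e * A.eval (σ n)⁻¹) atTop (𝓝 (A.coeff e)) := by
    have hterm : ∀ k ∈ Finset.range (A.natDegree + 1),
        Tendsto (fun n => A.coeff k * (σ n) ^ (e - k)) atTop
          (𝓝 (if k = e then A.coeff e else 0)) := by
      intro k hk
      rw [Finset.mem_range] at hk
      by_cases hke : k = e
      · subst hke
        simp only [if_true, Nat.sub_self, pow_zero, mul_one]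
        exact tendsto_const_nhds
      · rw [if_neg hke]
        have hlt : 0 < e - k := Nat.sub_pos_of_lt (lt_of_le_of_ne (by omega) hke)
        have := (hσlim.pow (e - k)).const_mul (A.coeff k)
        rwa [zero_pow hlt.ne', mul_zero] at this
    have hsum := tendsto_finsetSum (Finset.range (A.natDegree + 1)) hterm
    have hlim : (∑ k ∈ Finset.range (A.natDegree + 1), (if k = e then A.coeff e else 0)) =
        A.coeff e := by
      rw [Finset.sum_ite_eq' (Finset.range (A.natDegree + 1)) e (fun _ => A.coeff e)]
      split_ifs with hmem
      · rfl
      · rw [Finset.mem_range, not_lt] at hmem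
        exact (Polynomial.coeff_eq_zero_of_natDegree_lt (by omega)).symm
    rw [hlim] at hsum
    refine hsum.congr' ?_
    filter_upwards [eventually_gt_atTop 0] with n _
    rw [Polynomial.eval_eq_sum_range, Finset.mul_sum]
    refine Finset.sum_congr rfl fun k hk => ?_
    rw [Finset.mem_range] at hk
    have hke : k ≤ e := by omega
    rw [inv_pow, pow_sub₀ _ (hσne n) hke]
    ring
  have hratio : Tendsto (fun n => v n / u n) atTop (𝓝 (A.coeff e)) := by
    have hnum : Tendsto (fun n => 2 * ↑π * I * ((σ n) ^ e * A.eval (σ n)⁻¹) +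
        (σ n) ^ e * (2 * ↑π * I * g (σ n) + ℓv (σ n))) atTop
        (𝓝 (2 * ↑π * I * A.coeff e + 0 * (2 * ↑π * I * 0 + ℓv 0))) :=
      (hf.const_mul _).add (hpow.mul ((hgl.const_mul _).add hℓv))
    have hden : Tendsto (fun n => 2 * ↑π * I + (σ n) ^ e * ℓu (σ n)) atTop
        (𝓝 (2 * ↑π * I + 0 * ℓu 0)) :=
      tendsto_const_nhds.add (hpow.mul hℓu)
    have h2πI : (2 * ↑π * I : ℂ) ≠ 0 := by
      simp [Real.pi_ne_zero, Complex.I_ne_zero]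
    have hden0 : (2 * ↑π * I + 0 * ℓu 0 : ℂ) ≠ 0 := by rwa [zero_mul, add_zero]
    have := hnum.div hden hden0
    rw [zero_mul, add_zero, zero_mul, add_zero, mul_div_cancel_left₀ _ h2πI] at this
    refine this.congr' ?_
    filter_upwards [hularge.eventually (eventually_ge_atTop 1)] with n hn
    have hun : u n ≠ 0 := by
      intro h0; rw [h0, norm_zero] at hn; linarith
    have hσe : (σ n) ^ e ≠ 0 := pow_ne_zero _ (hσne n)
    have hden_eq : 2 * ↑π * I + (σ n) ^ e * ℓu (σ n) = (σ n) ^ e * u n := by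
      rw [hudef]; simp only; rw [inv_pow]; field_simp
    have hnum_eq : 2 * ↑π * I * ((σ n) ^ e * A.eval (σ n)⁻¹) +
        (σ n) ^ e * (2 * ↑π * I * g (σ n) + ℓv (σ n)) = (σ n) ^ e * v n := by
      rw [hvdef]; ring
    rw [Pi.div_apply, hnum_eq, hden_eq, mul_div_mul_left _ _ hσe]
  -- the rational relation between the two additive coordinates, in iterated form
  obtain ⟨R, hR0, hRW⟩ := exists_rat_relation_pair_of_zariskiDim_lt_two W hW hdim
    (Sum.inl (s.symm 0)) (Sum.inl (s.symm 1))
  obtain ⟨Q, hQ0, hQ⟩ := exists_bivariate_of_mvPolynomial R hR0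
  refine isAlgebraic_of_tendsto_div_of_eval₂_eq_zero Q hQ0 hularge hratio fun n => ?_
  rw [hQ]
  have hz := hRW _ (hbr (σ n) (hσpos n) (hσlt n))
  simpa [hudef, hvdef] using hz


/-- **The constant of a pure linear cusp is algebraic.** On a normalised log-free cusp ray of a
ℚ-closed `W` of dimension `< 2` whose jet is PURE, `A = a₀ + β w^e` (no terms of degree `1 … e−1`,
`deg A ≤ e`), the constant `γ₀ := 2πi·a₀ + ℓv 0 − β·ℓu 0 = lim (x_{i'} − β x_i)` is algebraic
(`CuspConstantAlgebraic` applied to the rational relation between the two additive coordinates, with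
the algebraic slope `β = A.coeff e` of `cusp_slope_isAlgebraic`). For `e = 1` the purity condition is
empty. This is the second arithmetic datum of the normal form of (★): it ties the constant term `a₀` of
the jet to ONE logarithm of the algebraic cusp values. -/
theorem cusp_constant_isAlgebraic
    (W : Set (Fin 2 ⊕ Fin 2 → ℂ)) (hW : IsDefinedOver (⊥ : Subfield ℂ) W) (hdim : zariskiDim ℂ W < 2)
    (s : Fin 2 ≃ Fin 2) (e : ℕ) (A : Polynomial ℂ) (g ℓu ℓv : ℂ → ℂ) (ρ : ℝ)
    (he : 0 < e) (hρ : 0 < ρ) (hg : AnalyticAt ℂ g 0) (hg0 : g 0 = 0)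
    (hu : AnalyticAt ℂ ℓu 0) (hv : AnalyticAt ℂ ℓv 0)
    (hbr : ∀ σ : ℂ, 0 < ‖σ‖ → ‖σ‖ < ρ →
      Sum.elim ((![2 * ↑π * I * σ⁻¹ ^ e + ℓu σ,
                    2 * ↑π * I * (A.eval σ⁻¹ + g σ) + ℓv σ] : Fin 2 → ℂ) ∘ s)
        ((![Complex.exp (ℓu σ), Complex.exp (ℓv σ)] : Fin 2 → ℂ) ∘ s) ∈ W)
    (hdeg : A.natDegree ≤ e) (hpure : ∀ k, 0 < k → k < e → A.coeff k = 0) :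
    IsAlgebraic ℚ (2 * ↑π * I * A.coeff 0 + ℓv 0 - A.coeff e * ℓu 0) := by
  have hβ : IsAlgebraic ℚ (A.coeff e) :=
    cusp_slope_isAlgebraic W hW hdim s e A g ℓu ℓv ρ he hρ hg hg0 hu hv hbr hdeg
  -- the sample points `σ_n = ρ/(n+2)` in the punctured disc
  set σ : ℕ → ℂ := fun n => ((ρ / ((n : ℝ) + 2) : ℝ) : ℂ) with hσ
  have hσnorm : ∀ n, ‖σ n‖ = ρ / ((n : ℝ) + 2) := fun n => by
    rw [hσ]; simp only [Complex.norm_real, Real.norm_eq_abs]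
    exact abs_of_pos (by positivity)
  have hσpos : ∀ n, 0 < ‖σ n‖ := fun n => by rw [hσnorm]; positivity
  have hσlt : ∀ n, ‖σ n‖ < ρ := fun n => by
    rw [hσnorm, div_lt_iff₀ (by positivity)]
    nlinarith
  have hσne : ∀ n, σ n ≠ 0 := fun n => norm_pos_iff.mp (hσpos n)
  have hσlim : Tendsto σ atTop (𝓝 0) := by
    have h0 : Tendsto (fun n => ‖σ n‖) atTop (𝓝 0) := by
      have h1 : Tendsto (fun n : ℕ => ρ / ((n : ℝ) + 2)) atTop (𝓝 0) := by
        have := (tendsto_const_div_atTop_nhds_zero_nat ρ).comp (tendsto_add_atTop_nat 2)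
        refine this.congr fun n => ?_
        simp only [Function.comp_apply, Nat.cast_add, Nat.cast_ofNat]
      exact h1.congr fun n => (hσnorm n).symm
    exact tendsto_zero_iff_norm_tendsto_zero.mpr h0
  have hℓu : Tendsto (fun n => ℓu (σ n)) atTop (𝓝 (ℓu 0)) :=
    (hu.continuousAt.tendsto).comp hσlim
  have hℓv : Tendsto (fun n => ℓv (σ n)) atTop (𝓝 (ℓv 0)) :=
    (hv.continuousAt.tendsto).comp hσlim
  have hgl : Tendsto (fun n => g (σ n)) atTop (𝓝 0) := by
    have := (hg.continuousAt.tendsto).comp hσlim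
    rwa [hg0] at this
  set u : ℕ → ℂ := fun n => 2 * ↑π * I * (σ n)⁻¹ ^ e + ℓu (σ n) with hudef
  set v : ℕ → ℂ := fun n => 2 * ↑π * I * (A.eval (σ n)⁻¹ + g (σ n)) + ℓv (σ n) with hvdef
  have hularge : Tendsto (fun n => ‖u n‖) atTop atTop := by
    have hmain : Tendsto (fun n => ‖2 * ↑π * I * (σ n)⁻¹ ^ e‖) atTop atTop := by
      have h1 : Tendsto (fun n : ℕ => ((n : ℝ) + 2) / ρ) atTop atTop :=
        Tendsto.atTop_div_const hρ (tendsto_natCast_atTop_atTop.atTop_add tendsto_const_nhds)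
      have h2 : Tendsto (fun n : ℕ => (2 * π) * (((n : ℝ) + 2) / ρ) ^ e) atTop atTop :=
        Tendsto.const_mul_atTop (by positivity) ((tendsto_pow_atTop he.ne') |>.comp h1)
      refine h2.congr fun n => ?_
      rw [norm_mul, norm_mul, norm_mul, norm_pow, norm_inv, hσnorm n, Complex.norm_I,
        Complex.norm_real, Real.norm_eq_abs, abs_of_pos Real.pi_pos, inv_div]
      norm_num
    have hbd : ∀ᶠ n in atTop, ‖ℓu (σ n)‖ ≤ ‖ℓu 0‖ + 1 := by
      have := hℓu.norm
      exact (this.eventually (gt_mem_nhds (lt_add_one _))).mono fun n hn => hn.le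
    have hlow : ∀ᶠ n in atTop, ‖2 * ↑π * I * (σ n)⁻¹ ^ e‖ - (‖ℓu 0‖ + 1) ≤ ‖u n‖ := by
      filter_upwards [hbd] with n hn
      have : ‖2 * ↑π * I * (σ n)⁻¹ ^ e‖ ≤ ‖u n‖ + ‖ℓu (σ n)‖ := by
        have h := norm_add_le (u n) (-ℓu (σ n))
        have huv : u n + -ℓu (σ n) = 2 * ↑π * I * (σ n)⁻¹ ^ e := by rw [hudef]; ring
        rw [huv, norm_neg] at h
        exact h
      linarith
    refine tendsto_atTop_mono' atTop hlow ?_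
    exact tendsto_atTop_add_const_right _ _ hmain
  -- purity: `A(σ⁻¹) = a₀ + β σ^{-e}`
  have hpureval : ∀ z : ℂ, A.eval z = A.coeff 0 + A.coeff e * z ^ e := by
    intro z
    rw [Polynomial.eval_eq_sum_range' (n := e + 1) (by omega), Finset.sum_range_succ]
    rcases Nat.eq_zero_or_pos e with h0 | _
    · omega
    · rw [Finset.sum_eq_single_of_mem 0 (Finset.mem_range.mpr (by omega))]
      · simp
      · intro k hk hk0
        rw [Finset.mem_range] at hk
        rw [hpure k (Nat.pos_of_ne_zero hk0) hk, zero_mul]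
  have hdiff : Tendsto (fun n => v n - A.coeff e * u n) atTop
      (𝓝 (2 * ↑π * I * A.coeff 0 + ℓv 0 - A.coeff e * ℓu 0)) := by
    have h1 : Tendsto (fun n => 2 * ↑π * I * A.coeff 0 + 2 * ↑π * I * g (σ n) + ℓv (σ n) -
        A.coeff e * ℓu (σ n)) atTop
        (𝓝 (2 * ↑π * I * A.coeff 0 + 2 * ↑π * I * 0 + ℓv 0 - A.coeff e * ℓu 0)) :=
      ((tendsto_const_nhds.add (hgl.const_mul _)).add hℓv).sub (hℓu.const_mul _)
    rw [mul_zero, add_zero] at h1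
    refine h1.congr fun n => ?_
    rw [hudef, hvdef]
    simp only [hpureval, inv_pow]
    ring
  obtain ⟨R, hR0, hRW⟩ := exists_rat_relation_pair_of_zariskiDim_lt_two W hW hdim
    (Sum.inl (s.symm 0)) (Sum.inl (s.symm 1))
  obtain ⟨Q, hQ0, hQ⟩ := exists_bivariate_of_mvPolynomial R hR0
  refine isAlgebraic_of_tendsto_sub_mul_of_eval₂_eq_zero Q hQ0 hβ hularge hdiff fun n => ?_
  rw [hQ]
  have hz := hRW _ (hbr (σ n) (hσpos n) (hσlt n))
  simpa [hudef, hvdef] using hz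


/-! ## Lead's sharpening of (R): rational jet UP TO A CONSTANT forces a vanishing tail (proved)

These four lemmas replace the registered stub `stub_rationalJetRunge` (landed p72001, the case `c = 0`)
inside the composition, so that the residual stub (★) may assume the jet is not `q(N) + c`, `q ∈ ℚ[X]`,
`c ∈ ℂ`. -/

/-- Clearing denominators: for `q ∈ ℚ[X]` there are `b ∈ ℤ ∖ 0` and `P ∈ ℤ[X]` with
`b · q(N) = P(N)` in `ℂ` for every `N : ℕ`. [folklore] -/
theorem exists_int_mul_ratPoly_eval_eq (q : Polynomial ℚ) :
    ∃ b : ℤ, b ≠ 0 ∧ ∃ P : Polynomial ℤ, ∀ N : ℕ,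
      (b : ℂ) * (q.map (algebraMap ℚ ℂ)).eval (N : ℂ) = ((P.eval (N : ℤ) : ℤ) : ℂ) := by
  obtain ⟨b, hb, hP⟩ := IsLocalization.integerNormalization_spec (nonZeroDivisors ℤ) q
  refine ⟨b, nonZeroDivisors.ne_zero hb, IsLocalization.integerNormalization (nonZeroDivisors ℤ) q,
    fun N => ?_⟩
  have h1 : ((b • q).map (algebraMap ℚ ℂ)).eval (N : ℂ) =
      (b : ℂ) * (q.map (algebraMap ℚ ℂ)).eval (N : ℂ) := by
    rw [zsmul_eq_mul, Polynomial.map_mul, Polynomial.map_intCast, Polynomial.eval_mul,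
      Polynomial.eval_intCast]
  rw [← h1, ← hP, Polynomial.map_map, Polynomial.eval_map, Polynomial.eval₂_at_natCast, eq_intCast]

/-- **Theorem R with a constant shift.** If `g` is analytic at `0` with `g 0 = 0`, the sample
points `t N` tend to `0` avoiding `0`, and `q(N) + c + g(t N) ∈ ℤ` for infinitely many `N`
(`q ∈ ℚ[X]`, `c ∈ ℂ` arbitrary), then `g ≡ 0` near `0`. Proof: with `b q(N) ∈ ℤ`, the numbers
`u_N := b (c + g(t N))` are integers at hits and converge to `b c` along `atTop`; two integers within
`1/4` of the same complex number coincide, so `g (t N)` takes ONE value `κ` at all large hits; as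
`g (t N) → 0` along the (infinite) hit set, `κ = 0`; the identity theorem concludes. [folklore] -/
theorem eventually_zero_of_infinite_shifted_hits {q : Polynomial ℚ} {c : ℂ} {g : ℂ → ℂ}
    {t : ℕ → ℂ} (hg : AnalyticAt ℂ g 0) (hg0 : g 0 = 0) (ht : Tendsto t atTop (𝓝[≠] 0))
    (hinf : Set.Infinite {N : ℕ | ∃ L : ℤ,
      (q.map (algebraMap ℚ ℂ)).eval (N : ℂ) + c + g (t N) = L}) :
    ∀ᶠ z in 𝓝 (0 : ℂ), g z = 0 := by
  have ht0 : Tendsto t atTop (𝓝 0) := ht.mono_right nhdsWithin_le_nhds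
  obtain ⟨b, hb, P, hP⟩ := exists_int_mul_ratPoly_eval_eq q
  -- `g (t N) → 0`
  have hg' : Tendsto (fun N => g (t N)) atTop (𝓝 0) := by
    have h := hg.continuousAt.tendsto.comp ht0
    rwa [hg0] at h
  -- `b * (c + g (t N)) → b * c`
  have hbg : Tendsto (fun N => (b : ℂ) * (c + g (t N))) atTop (𝓝 ((b : ℂ) * c)) := by
    have := (hg'.const_add c).const_mul (b : ℂ)
    simpa using this
  have hsmall : ∀ᶠ N in atTop, ‖(b : ℂ) * (c + g (t N)) - (b : ℂ) * c‖ < 1 / 4 := by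
    have h := (hbg.sub_const ((b : ℂ) * c)).norm
    rw [sub_self, norm_zero] at h
    exact h.eventually (gt_mem_nhds (by norm_num))
  -- at a hit, `b * (c + g (t N))` is an integer
  have hint : ∀ N : ℕ, (∃ L : ℤ, (q.map (algebraMap ℚ ℂ)).eval (N : ℂ) + c + g (t N) = L) →
      ∃ M : ℤ, (b : ℂ) * (c + g (t N)) = M := by
    rintro N ⟨L, hL⟩
    refine ⟨b * L - P.eval (N : ℤ), ?_⟩
    have h2 : (b : ℂ) * (c + g (t N)) = b * L - (b : ℂ) * (q.map (algebraMap ℚ ℂ)).eval (N : ℂ) := by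
      rw [← hL]; ring
    rw [h2, hP N]; push_cast; ring
  -- the hits are frequent
  have hfreq : ∃ᶠ N : ℕ in atTop,
      ∃ L : ℤ, (q.map (algebraMap ℚ ℂ)).eval (N : ℂ) + c + g (t N) = L :=
    Nat.frequently_atTop_iff_infinite.mpr hinf
  -- pick one large hit `N₀`; every other large hit has the same value of `g ∘ t`
  obtain ⟨N₀, hN₀small, hN₀hit⟩ := (hsmall.and_frequently hfreq).exists
  obtain ⟨M₀, hM₀⟩ := hint N₀ hN₀hit
  have hconst : ∀ᶠ N : ℕ in atTop,
      (∃ L : ℤ, (q.map (algebraMap ℚ ℂ)).eval (N : ℂ) + c + g (t N) = L) →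
        g (t N) = g (t N₀) := by
    filter_upwards [hsmall] with N hN hhit
    obtain ⟨M, hM⟩ := hint N hhit
    have hdist : ‖((M : ℂ)) - (M₀ : ℂ)‖ < 1 := by
      have h1 : ‖(b : ℂ) * (c + g (t N)) - (b : ℂ) * c‖ < 1 / 4 := hN
      have h2 : ‖(b : ℂ) * (c + g (t N₀)) - (b : ℂ) * c‖ < 1 / 4 := hN₀small
      rw [hM] at h1
      rw [hM₀] at h2
      calc ‖(M : ℂ) - (M₀ : ℂ)‖ = ‖((M : ℂ) - (b : ℂ) * c) - ((M₀ : ℂ) - (b : ℂ) * c)‖ := by ring_nf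
        _ ≤ ‖(M : ℂ) - (b : ℂ) * c‖ + ‖(M₀ : ℂ) - (b : ℂ) * c‖ := norm_sub_le _ _
        _ < 1 / 4 + 1 / 4 := add_lt_add h1 h2
        _ < 1 := by norm_num
    have hMM : M = M₀ := by
      have : |(M - M₀ : ℤ)| < 1 := by
        rw [← Int.cast_sub, Complex.norm_intCast] at hdist
        exact_mod_cast hdist
      linarith [Int.abs_lt_one_iff.mp this]
    have hbne : (b : ℂ) ≠ 0 := Int.cast_ne_zero.mpr hb
    have : (b : ℂ) * (c + g (t N)) = (b : ℂ) * (c + g (t N₀)) := by rw [hM, hM₀, hMM]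
    have := mul_left_cancel₀ hbne this
    exact add_left_cancel this
  -- the common value is `0`, because `g (t N) → 0` along the infinite hit set
  have hκ : g (t N₀) = 0 := by
    by_contra hne
    have hpos : 0 < ‖g (t N₀)‖ := norm_pos_iff.mpr hne
    have hev : ∀ᶠ N in atTop, ‖g (t N)‖ < ‖g (t N₀)‖ := by
      have h := hg'.norm
      rw [norm_zero] at h
      exact h.eventually (gt_mem_nhds hpos)
    obtain ⟨N, ⟨hN1, hN2⟩, hN3⟩ := ((hev.and hconst).and_frequently hfreq).exists
    have := hN2 hN3
    rw [this] at hN1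
    exact lt_irrefl _ hN1
  have hzero : ∀ᶠ N : ℕ in atTop,
      (∃ L : ℤ, (q.map (algebraMap ℚ ℂ)).eval (N : ℂ) + c + g (t N) = L) → g (t N) = 0 := by
    filter_upwards [hconst] with N hN hhit
    rw [hN hhit, hκ]
  have hfreq0 : ∃ᶠ z in 𝓝[≠] (0 : ℂ), g z = 0 := ht.frequently (hfreq.mp hzero)
  exact hg.frequently_zero_iff_eventually_zero.mp hfreq0

/-- The ray points `σ_N = (N^{1/e})⁻¹` (`e ≥ 1`) tend to `0` within `{0}ᶜ`. [folklore] -/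
theorem tendsto_rayPoint_nhdsNE {e : ℕ} (he : 0 < e) :
    Tendsto (fun N : ℕ => ((((N : ℝ) ^ ((e : ℝ)⁻¹) : ℝ) : ℂ))⁻¹) atTop (𝓝[≠] 0) := by
  have hpos : (0 : ℝ) < (e : ℝ)⁻¹ := inv_pos.mpr (by exact_mod_cast he)
  have h1 : Tendsto (fun N : ℕ => (N : ℝ) ^ ((e : ℝ)⁻¹)) atTop atTop :=
    (tendsto_rpow_atTop hpos).comp tendsto_natCast_atTop_atTop
  have h2 : Tendsto (fun N : ℕ => ((((N : ℝ) ^ ((e : ℝ)⁻¹) : ℝ) : ℂ))⁻¹) atTop (𝓝 0) := by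
    have h3 := (Complex.continuous_ofReal.tendsto 0).comp h1.inv_tendsto_atTop
    rw [Complex.ofReal_zero] at h3
    refine Tendsto.congr (fun N => ?_) h3
    simp only [Function.comp_apply, Pi.inv_apply, Complex.ofReal_inv]
  refine tendsto_nhdsWithin_iff.mpr ⟨h2, ?_⟩
  filter_upwards [eventually_gt_atTop 0] with N hN
  exact inv_ne_zero
    (Complex.ofReal_ne_zero.mpr (Real.rpow_pos_of_pos (Nat.cast_pos.mpr hN) _).ne')

/-- **Theorem R, shifted, on the ray.** If `e ≥ 1`, `q ∈ ℚ[X]`, `c ∈ ℂ`, `g` analytic at `0` with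
`g 0 = 0`, and `q(N) + c + g(N^{-1/e}) ∈ ℤ` for infinitely many `N : ℕ`, then `g ≡ 0` near `0`.
[folklore] -/
theorem rationalJetShift_eventually_zero :
    ∀ (e : ℕ), 0 < e → ∀ (q : Polynomial ℚ) (c : ℂ) (g : ℂ → ℂ), AnalyticAt ℂ g 0 → g 0 = 0 →
      Set.Infinite {N : ℕ | ∃ L : ℤ,
        (q.map (algebraMap ℚ ℂ)).eval (N : ℂ) + c + g ((((N : ℝ) ^ ((e : ℝ)⁻¹) : ℝ) : ℂ))⁻¹ = L} →
      ∀ᶠ z in 𝓝 (0 : ℂ), g z = 0 :=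
  fun _e he _q _c _g hg hg0 hinf =>
    eventually_zero_of_infinite_shifted_hits hg hg0 (tendsto_rayPoint_nhdsNE he) hinf


/-! ## The composition (sorry-free) -/

/-- **`SparsityTwo_of_statements`** — the five remaining stub STATEMENTS (E, H, Im, S, ★) imply the crux
((R) is discharged inline in its shifted form `rationalJetShift_eventually_zero`). Pure logic plus one witness:
by contradiction the independent hits are infinite; `stub_cuspEscape` relocates them to a normalised
log-free cusp ray with transcendental tail (1), a degenerate section (2) or a constant-exponential fibre (3);
(2) and (3) contradict `stub_classicalClassesFinite`; in (1), a jet that is a rational polynomial plus a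
constant feeds `rationalJetShift_eventually_zero`, whose conclusion `g ≡ 0 near 0` contradicts transcendence
with the polynomial `P = X₁`; a non-real jet or
tail contradicts `stub_nonRealJetFinite`; otherwise `stub_cuspZeroLogDensity` supplies lacunarity and
`stub_realArithmeticCuspFinite` finiteness of the (infinite) ray hits. Its conclusion is the crux UNFOLDED
(`indepExpPoints W` is the crux's set-builder by `rfl`), so that the skeleton audit — which admits hypotheses
only by name — examines the hypothesis-free `SparsityTwo_of` below, which is this theorem applied to the
stubs and concludes `RigidCore.SparsityTwo` BY NAME. Axioms of this composition: propext, Classical.choice,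
Quot.sound (no `sorryAx`). -/
theorem SparsityTwo_of_statements :
    type_of% stub_cuspEscape → type_of% stub_classicalClassesFinite →
    type_of% stub_nonRealJetFinite →
    type_of% stub_cuspZeroLogDensity → type_of% stub_realArithmeticCuspFinite →
    ∀ (W : Set (Fin 2 ⊕ Fin 2 → ℂ)), IsDefinedOver (⊥ : Subfield ℂ) W → zariskiDim ℂ W < 2 →
      (indepExpPoints W).Finite := by
  intro hE hH hIm hS hA W hW hdim
  by_contra hinf
  rcases hE W hW hdim hinf with ⟨s, e, A, g, ℓu, ℓv, ρ, h⟩ | ⟨a, b, hab, c, hinf'⟩ | ⟨ω, hinf'⟩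
  · -- (1) a normalised log-free cusp ray with transcendental tail and infinitely many ray hits
    obtain ⟨he, hρ, hg, hg0, hu, hv, htr, hbr, hray⟩ := h
    by_cases hrat : ∃ (q : Polynomial ℚ) (c : ℂ), ∀ N : ℕ,
        A.eval ((((N : ℝ) ^ ((e : ℝ)⁻¹) : ℝ) : ℂ)) = (q.map (algebraMap ℚ ℂ)).eval (N : ℂ) + c
    · -- rational jet up to a constant: the shifted Runge lemma forces `g ≡ 0` near `0`,
      -- contradicting transcendence (`P = X₁`)
      obtain ⟨q, c, hq⟩ := hrat
      have hz : ∀ᶠ z in 𝓝 (0 : ℂ), g z = 0 := by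
        refine rationalJetShift_eventually_zero e he q c g hg hg0 (hray.mono ?_)
        intro N hN
        obtain ⟨L, hL⟩ := hN.2.2
        refine ⟨L, ?_⟩
        rw [← hq N]
        exact hL
      exact htr ⟨MvPolynomial.X 1, MvPolynomial.X_ne_zero _, by
        filter_upwards [hz] with z hz
        simp [hz]⟩
    · by_cases hreal : (∀ k : ℕ, (A.coeff k).im = 0) ∧ ∀ᶠ t : ℝ in 𝓝[>] 0, (g (t : ℂ)).im = 0
      · -- real, non-rational jet: lacunarity (S), then the arithmetic residual stub
        exact hray (hA W hW hdim s e A g ℓu ℓv ρ he hρ hg hg0 hu hv htr hbr hrat hreal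
          (hS e he A g hg hg0 htr)
          (cusp_values_isAlgebraic W hW hdim s e A g ℓu ℓv ρ he hρ hu hv hbr).1
          (cusp_values_isAlgebraic W hW hdim s e A g ℓu ℓv ρ he hρ hu hv hbr).2
          (cusp_slope_isAlgebraic W hW hdim s e A g ℓu ℓv ρ he hρ hg hg0 hu hv hbr)
          (fun hd hp => cusp_constant_isAlgebraic W hW hdim s e A g ℓu ℓv ρ he hρ hg hg0 hu hv hbr hd hp))
      · -- non-real jet or tail: finitely many integer points outright
        exact hray ((hIm e he A g hg hg0 hreal).subset fun N hN => hN.2.2)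
  · -- (2) degenerate section
    exact hinf' ((hH W hW hdim).1 a b hab c)
  · -- (3) constant exponential
    exact hinf' ((hH W hW hdim).2 ω)

/-- **`SparsityTwo_of`** — the crux along this line, MODULO the registered stubs still open (references every
open `stub_*`, so the audit shows exactly which sorries the crux still depends on; landed stubs are imported
under the same fully-qualified names). Concludes `Summit.Schanuel.Schanuel.Theses.RigidCore.SparsityTwo` by name. -/
theorem SparsityTwo_of : Summit.Schanuel.Schanuel.Theses.RigidCore.SparsityTwo :=
  SparsityTwo_of_statements stub_cuspEscape stub_classicalClassesFinite
    stub_nonRealJetFinite stub_cuspZeroLogDensity stub_realArithmeticCuspFinite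

end Summit.Schanuel.Schanuel.Cruxes.SparsityTwo.CuspGermSchneiderSparsity
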